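import Literature.Computability.Cryptography.HallgrenClassGroupComposeFP
import Literature.Computability.Cryptography.HallgrenClassGroupOrderInj
import HarnessLib

/-!
# Hallgren 2005 / class numbers under GRH — programming step P3: Gauss reduction and the guarded
# composition of forms in the typed polynomial-time algebra `CodeFP`

Topic `Literature/Computability/Cryptography`; proof companion of `HallgrenClassGroup.lean`
(named fact `Hallgren2005_classNumber_qsolvable_of_GRH`). Definitions and theorems; no named fact.
Sequel of `HallgrenClassGroupComposeFP.lean` (`rawComposeC`) and `HallgrenClassGroupReduction.lean`
(`step`, `reduce = step^[log₂ a + 4]`). The `CodeFP` fold needs a polynomial bound on its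
accumulator for EVERY typed input, not only for the positive definite forms met on the true run, so
the loops are written with GUARDED steps (identity off the positive definite forms of the
discriminant at hand), equal to the ungarded ones on valid data:

* `stepC` (one Gauss step on codes), the guard `posDef D f = (0 < a ∧ disc f = D ∧ D < 0)`,
  `stepG`, the coefficient bound along guarded iterations `coeffs_stepG_iterate_le`
  (`a` does not increase, `|b| ≤ a`, `c = (b² − D)/(4a)`), `stepGIterC`;
* `reduceG D f = stepG D ^[|formE f| + 4] f` — **`reduceG_eq_reduce`** on primitive positive definite
  forms (the budget exceeds `reduceSteps`, and reduced forms are fixed) — and `reduceGC`;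
* the guarded composition **`composeG D f g`** (= `compose D f g` on primitive positive definite
  `f, g`, `composeG_eq_compose`; the first argument otherwise), its values are bounded by
  `|D|` or by the input (`coeffBound_composeG`), and **`composeGC`**.

## References

* D. A. Cox, *Primes of the form x² + ny²*, 2nd ed. (2013), §2.A Thm. 2.8, §3.A [Cox2013].
* S. Arora, B. Barak, *Computational Complexity: A Modern Approach*, CUP 2009, §1.3 [AroraBarak2009].
-/

namespace Literature.Computability.Cryptography.Hallgren2005

namespace ClFP

open Literature.Computability.Complexity Literature.Computability.Complexity.CodeFP Polynomial
open Literature.NumberTheory.QuadraticFields.Quadratic (BinQF)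
open Literature.NumberTheory.QuadraticFields.Quadratic.BinQF (IsPosPrim)
open FormComposition Reduction OrderCl

/-! ### One Gauss step on codes -/

/-- `normalizeB` on codes. [folklore] -/
theorem normalizeBC : CodeFP formE formE normalizeB := by
  have ha := aC
  have hb := bC
  have hc := cC
  have h2 : CodeFP formE intE (fun _ => (2 : ℤ)) := const formE (2 : ℤ)
  -- `k = (a - b) / (2a)`
  have hk := intEDiv.comp ((intSub.comp (ha.pair hb)).pair (intMul.comp (h2.pair ha)))
  have hb' := intAdd.comp (hb.pair (intMul.comp ((intMul.comp (h2.pair ha)).pair hk)))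
  have hc' := intAdd.comp ((intAdd.comp ((intMul.comp (ha.pair (intMul.comp (hk.pair hk)))).pair
    (intMul.comp (hb.pair hk)))).pair hc)
  refine (mkFormC.comp (ha.pair (hb'.pair hc'))).congr fun f => ?_
  simp only [normalizeB, normShift, sq]

/-- `NeedsSwap` as a Boolean. [folklore] -/
theorem needsSwapC : CodeFP formE bitE (fun g => decide (NeedsSwap g)) := by
  have ha := aC
  have hb := bC
  have hc := cC
  have h0 : CodeFP formE intE (fun _ => (0 : ℤ)) := const formE (0 : ℤ)
  have h1 := intLt.comp (hc.pair ha)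
  have h2 := (intEq.comp (ha.pair hc)).and (intLt.comp (hb.pair h0))
  refine (h1.or h2).congr fun g => ?_
  simp only [NeedsSwap, Bool.decide_or, Bool.decide_and]

/-- `swapS` on codes. [folklore] -/
theorem swapSC : CodeFP formE formE swapS :=
  (mkFormC.comp (cC.pair ((intNeg.comp bC).pair aC))).congr fun _ => rfl

/-- **One Gauss step on codes.** [cite: Cox2013, §2.A Thm. 2.8 (proof)] -/
theorem stepC : CodeFP formE formE step := by
  have hn := normalizeBC
  have h := ite (needsSwapC.comp hn) (swapSC.comp hn) hn
  refine h.congr fun f => ?_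
  rw [step]
  by_cases hs : NeedsSwap (normalizeB f)
  · simp [hs]
  · simp [hs]

/-! ### The guard and the coefficient bound -/

/-- The guard: positive definite of discriminant `D < 0`. [folklore] -/
def posDef (D : ℤ) (f : BinQF) : Prop := 0 < f.a ∧ f.disc = D ∧ D < 0

/-- The guard is decidable. [folklore] -/
instance (D : ℤ) (f : BinQF) : Decidable (posDef D f) := inferInstanceAs (Decidable (_ ∧ _ ∧ _))

/-- The guard on codes. [folklore] -/
theorem posDefC : CodeFP (pairE intE formE) bitE (fun p => decide (posDef p.1 p.2)) := by
  have hD : CodeFP (pairE intE formE) intE (fun p => p.1) := fst intE formE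
  have hf : CodeFP (pairE intE formE) formE (fun p => p.2) := snd intE formE
  have ha := aC.comp hf
  have hb := bC.comp hf
  have hc := cC.comp hf
  have h0 : CodeFP (pairE intE formE) intE (fun _ => (0 : ℤ)) := const _ (0 : ℤ)
  have h4 : CodeFP (pairE intE formE) intE (fun _ => (4 : ℤ)) := const _ (4 : ℤ)
  have hdisc := intSub.comp ((intMul.comp (hb.pair hb)).pair (intMul.comp ((intMul.comp (h4.pair ha)).pair hc)))
  have h := (intLt.comp (h0.pair ha)).and ((intEq.comp (hdisc.pair hD)).and (intLt.comp (hD.pair h0)))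
  refine h.congr fun p => ?_
  simp only [posDef, BinQF.disc, sq, Bool.decide_and]

/-- **The guarded Gauss step.** [folklore] -/
def stepG (D : ℤ) (f : BinQF) : BinQF := if posDef D f then step f else f

/-- `stepG` on codes. [folklore] -/
theorem stepGC : CodeFP (pairE intE formE) formE (fun p => stepG p.1 p.2) := by
  have hf : CodeFP (pairE intE formE) formE (fun p => p.2) := snd intE formE
  have h := ite posDefC (stepC.comp hf) hf
  refine h.congr fun p => ?_
  rw [stepG]
  by_cases hp : posDef p.1 p.2 <;> simp [hp]

/-- The guard is preserved by a Gauss step (discriminant and positivity of `a`). [folklore] -/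
theorem posDef_step {D : ℤ} {f : BinQF} (h : posDef D f) : posDef D (step f) := by
  obtain ⟨ha, hdisc, hD⟩ := h
  have hdn : (normalizeB f).disc = D := by rw [← hdisc]; simp only [normalizeB, BinQF.disc]; ring
  refine ⟨?_, ?_, hD⟩
  · rw [step]
    split_ifs with hs
    · -- new `a` is the old `c'`, positive
      show 0 < (normalizeB f).c
      have hb := (normalizeB_b_bounds ha).1
      have : (normalizeB f).b ^ 2 - 4 * (normalizeB f).a * (normalizeB f).c = D := hdn
      have haa : (normalizeB f).a = f.a := rfl
      nlinarith [sq_nonneg (normalizeB f).b]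
    · exact ha
  · rw [step]
    split_ifs with hs
    · rw [← hdn]; simp only [swapS, BinQF.disc]; ring
    · exact hdn

/-- The guarded step is the step on positive definite forms. [folklore] -/
theorem stepG_eq_step {D : ℤ} {f : BinQF} (h : posDef D f) : stepG D f = step f := if_pos h

/-- Iterates of the guarded step on positive definite forms. [folklore] -/
theorem stepG_iterate_eq {D : ℤ} {f : BinQF} (h : posDef D f) : ∀ n, (stepG D)^[n] f = step^[n] f
  | 0 => rfl
  | n + 1 => by
    rw [Function.iterate_succ_apply, Function.iterate_succ_apply, stepG_eq_step h]
    exact stepG_iterate_eq (posDef_step h) n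

/-- **Coefficient bound for one guarded step**: with `M` a bound for `a` and `B = M² + |D| + M`,
if `0 < a ≤ M` and `|b|, |c| ≤ B₀` then the output has `0 < a' ≤ M`, `|b'| ≤ M`, `0 ≤ c' ≤ M² + |D|`.
[cite: Cox2013, §2.A Thm. 2.8 (proof)] -/
theorem coeffs_step_le {D M : ℤ} {f : BinQF} (h : posDef D f) (hM : f.a ≤ M) :
    0 < (step f).a ∧ (step f).a ≤ M ∧ |(step f).b| ≤ M ∧ 0 ≤ (step f).c ∧ (step f).c ≤ M ^ 2 + |D| := by
  obtain ⟨ha, hdisc, hD⟩ := h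
  set g := normalizeB f with hg
  have hga : g.a = f.a := rfl
  obtain ⟨hb1, hb2⟩ := normalizeB_b_bounds ha
  rw [← hg] at hb1 hb2
  have hgd : g.b ^ 2 - 4 * g.a * g.c = D := by
    rw [← hdisc]; simp only [hg, normalizeB, BinQF.disc]; ring
  have habs : |g.b| ≤ f.a := abs_le.2 ⟨by linarith, by rw [← hga]; exact hb2⟩
  have hgc0 : 0 < g.c := by nlinarith [sq_nonneg g.b]
  -- `4 a c' = b'² − D ≤ a² + |D|`, so `c' ≤ a² + |D|`
  have hgc : g.c ≤ M ^ 2 + |D| := by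
    have h1 : 4 * f.a * g.c = g.b ^ 2 - D := by rw [← hga]; linarith
    have h2 : g.b ^ 2 ≤ f.a ^ 2 := by nlinarith [abs_nonneg g.b, abs_mul_abs_self g.b, sq_abs g.b]
    have h3 : -D ≤ |D| := neg_le_abs D
    have h4 : f.a ^ 2 ≤ M ^ 2 := by nlinarith
    nlinarith
  rw [step, ← hg]
  split_ifs with hs
  · simp only [swapS]
    have hM1 : (1 : ℤ) ≤ M := by linarith
    refine ⟨hgc0, ?_, ?_, by rw [hga]; exact ha.le, by rw [hga]; nlinarith [abs_nonneg D]⟩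
    · rcases hs with hs | ⟨hs, -⟩
      · linarith [hs, hga]
      · rw [← hs, hga]; exact hM
    · rw [abs_neg]; exact habs.trans hM
  · exact ⟨by rw [hga]; exact ha, by rw [hga]; exact hM, habs.trans hM, hgc0.le, hgc⟩

/-- **Coefficients along guarded iterations** (`n ≥ 1`): `0 < a ≤ a₀`, `|b| ≤ a₀`, `0 ≤ c ≤ a₀² + |D|`;
off the guard nothing moves. [cite: Cox2013, §2.A Thm. 2.8 (proof)] -/
theorem coeffs_stepG_iterate_le (D : ℤ) (f : BinQF) (n : ℕ) :
    (stepG D)^[n] f = f ∨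
      (0 < ((stepG D)^[n] f).a ∧ ((stepG D)^[n] f).a ≤ f.a ∧ |((stepG D)^[n] f).b| ≤ f.a ∧
        0 ≤ ((stepG D)^[n] f).c ∧ ((stepG D)^[n] f).c ≤ f.a ^ 2 + |D|) := by
  by_cases h : posDef D f
  · induction n with
    | zero => exact Or.inl rfl
    | succ n ih =>
      right
      have hpn : posDef D ((stepG D)^[n] f) := by
        rw [stepG_iterate_eq h]
        clear ih
        induction n with
        | zero => exact h
        | succ n ih => rw [Function.iterate_succ_apply']; exact posDef_step ih
      have han : ((stepG D)^[n] f).a ≤ f.a := by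
        rcases ih with ih | ih
        · rw [ih]
        · exact ih.2.1
      rw [Function.iterate_succ_apply', stepG_eq_step hpn]
      exact coeffs_step_le hpn han
  · left
    have hfix : stepG D f = f := if_neg h
    exact Function.iterate_fixed hfix n

/-- An integer bounded in absolute value has a short code. [folklore] -/
theorem length_intE_le_of_abs_le' {z B : ℤ} (h : |z| ≤ B) : (intE z).length ≤ 3 * Nat.size B.toNat + 2 := by
  refine length_intE_le_of_abs_le (B := B.toNat) ?_
  have : (0 : ℤ) ≤ B := (abs_nonneg z).trans h
  rwa [Int.toNat_of_nonneg this]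

/-- The code length of a form is controlled by a bound on its coefficients. [folklore] -/
theorem length_formE_le_of_bounds {f : BinQF} {B : ℤ} (ha : |f.a| ≤ B) (hb : |f.b| ≤ B) (hc : |f.c| ≤ B) :
    (formE f).length ≤ 15 * Nat.size B.toNat + 14 := by
  have e : formE f = boolPair (intE f.a) (boolPair (intE f.b) (intE f.c)) := rfl
  rw [e, length_boolPair, length_boolPair]
  have := length_intE_le_of_abs_le' ha
  have := length_intE_le_of_abs_le' hb
  have := length_intE_le_of_abs_le' hc
  omega

/-- The absolute value of an integer is controlled by the length of its code: `|z| < 2^{|intE z|}`. [folklore] -/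
theorem abs_lt_two_pow_length_intE (z : ℤ) : |z| < 2 ^ (intE z).length := by
  have h1 : z.natAbs < 2 ^ (_root_.Computability.encodeNat z.natAbs).length := by
    simpa using bitsToNat_lt (_root_.Computability.encodeNat z.natAbs)
  have h2 : (_root_.Computability.encodeNat z.natAbs).length ≤ (intE z).length := by
    have := Brick.zlen_dpEnc z
    have := Brick.zlen_le_length (Brick.dpEnc z)
    change (_root_.Computability.encodeNat z.natAbs).length ≤ (Brick.dpEnc z).length
    omega
  have h3 : (z.natAbs : ℤ) < 2 ^ (intE z).length := by
    have := Nat.pow_le_pow_right (show 0 < 2 by norm_num) h2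
    exact_mod_cast h1.trans_le this
  rwa [Int.natCast_natAbs] at h3

/-- Sizes of small polynomials in a bound: `size (B² + E + B) ≤ 2 size B + size E + 2`-type estimate,
in the crude form `size (x) ≤ k` from `x < 2^k`. [folklore] -/
theorem size_toNat_le_of_lt {x : ℤ} {k : ℕ} (h0 : 0 ≤ x) (h : x < 2 ^ k) : Nat.size x.toNat ≤ k := by
  rw [Nat.size_le]
  have : (x.toNat : ℤ) < 2 ^ k := by rwa [Int.toNat_of_nonneg h0]
  exact_mod_cast this

/-- **The guarded iteration along a unit budget is computed on codes** (fold; the accumulator is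
either the input or has coefficients `≤ a₀² + |D|`). [cite: AroraBarak2009, §1.3 (polynomially bounded loops)] -/
theorem stepGIterC : CodeFP (pairE (pairE intE formE) (rawE unitE)) formE
    (fun p => (stepG p.1.1)^[p.2.length] p.1.2) := by
  have hinit : CodeFP (pairE intE formE) formE (fun p => p.2) := snd intE formE
  have hstep := stepGC.comp ((fst (pairE intE formE) (pairE unitE formE)).fst'.pair
    (snd (pairE intE formE) (pairE unitE formE)).snd')
  have hfold : ∀ (p : ℤ × BinQF) (l : List Unit), l.foldl (fun b _ => stepG p.1 b) p.2 = (stepG p.1)^[l.length] p.2 := by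
    intro p l
    induction l generalizing p with
    | nil => rfl
    | cons _ l ih =>
      rw [List.foldl_cons, List.length_cons, Function.iterate_succ_apply]
      exact ih (p.1, stepG p.1 p.2)
  have h := foldl (σ := ℤ × BinQF) (α := Unit) (β := BinQF) (eσ := pairE intE formE) (eα := unitE) (eβ := formE)
    (step := fun p _ b => stepG p.1 b) (init := fun p => p.2) hstep hinit (C 15 * X + C 29) (fun p l₁ l₂ => by
      rw [hfold]
      simp only [eval_add, eval_mul, eval_C, eval_X, pairE_apply, length_boolPair]
      set W := (boolPair (boolPair (intE p.1) (formE p.2)) (rawE unitE (l₁ ++ l₂))).length with hW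
      have hWdef : W = 2 * (2 * (intE p.1).length + 2 + (formE p.2).length) + 2 + (rawE unitE (l₁ ++ l₂)).length := by
        rw [hW, length_boolPair, length_boolPair]
      have hfa : (intE p.2.a).length ≤ (formE p.2).length := by
        have e : formE p.2 = boolPair (intE p.2.a) (boolPair (intE p.2.b) (intE p.2.c)) := rfl
        rw [e, length_boolPair]; omega
      rcases coeffs_stepG_iterate_le p.1 p.2 l₁.length with heq | ⟨h1, h2, h3, h4, h5⟩
      · rw [heq]; omega
      · -- all coefficients are at most `a₀² + |D| ≤ 2^{2|a₀| + |D|}`-ish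
        set B : ℤ := p.2.a ^ 2 + |p.1| with hB
        have ha0 : 0 < p.2.a := lt_of_lt_of_le h1 h2
        have hBa : p.2.a ≤ B := by rw [hB]; nlinarith [abs_nonneg p.1]
        have hb1 : |((stepG p.1)^[l₁.length] p.2).a| ≤ B := by rw [abs_of_pos h1]; exact h2.trans hBa
        have hb2 : |((stepG p.1)^[l₁.length] p.2).b| ≤ B := h3.trans hBa
        have hb3 : |((stepG p.1)^[l₁.length] p.2).c| ≤ B := by rw [abs_of_nonneg h4]; exact h5
        refine (length_formE_le_of_bounds hb1 hb2 hb3).trans ?_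
        -- `size B ≤ 2 |intE a| + |intE D| + 1`
        have hA := abs_lt_two_pow_length_intE p.2.a
        have hDl := abs_lt_two_pow_length_intE p.1
        rw [abs_of_pos ha0] at hA
        have hBlt : B < 2 ^ (2 * (intE p.2.a).length + (intE p.1).length + 1) := by
          have hX : (1 : ℤ) ≤ (2 ^ (intE p.2.a).length) ^ 2 := one_le_pow₀ (one_le_pow₀ one_le_two)
          have hY : (1 : ℤ) ≤ 2 ^ (intE p.1).length := one_le_pow₀ one_le_two
          have h2a : p.2.a ^ 2 < (2 ^ (intE p.2.a).length) ^ 2 := by nlinarith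
          rw [show (2 : ℤ) ^ (2 * (intE p.2.a).length + (intE p.1).length + 1) =
            (2 ^ (intE p.2.a).length) ^ 2 * 2 ^ (intE p.1).length * 2 by ring, hB]
          nlinarith [mul_nonneg (sub_nonneg.2 hX) (sub_nonneg.2 hY), abs_nonneg p.1]
        have hsz := size_toNat_le_of_lt (by rw [hB]; positivity) hBlt
        omega)
  exact h.congr fun p => by rw [hfold]

/-! ### The guarded reduction -/

/-- **The guarded reduction**: `|formE f| + 4` guarded steps (at least `reduceSteps f`). [cite: Cox2013, §2.A Thm. 2.8] -/
def reduceG (D : ℤ) (f : BinQF) : BinQF := (stepG D)^[(formE f).length + 4] f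

/-- The budget exceeds `reduceSteps`. [folklore] -/
theorem reduceSteps_le_budget (f : BinQF) : reduceSteps f ≤ (formE f).length + 4 := by
  rw [reduceSteps]
  have h1 : Nat.log 2 f.a.toNat ≤ Nat.size f.a.toNat := by
    rcases Nat.eq_zero_or_pos f.a.toNat with h0 | hpos
    · rw [h0, Nat.log_zero_right]; exact Nat.zero_le _
    · have := Nat.lt_size_self f.a.toNat
      exact Nat.le_of_lt_succ ((Nat.log_lt_iff_lt_pow Nat.one_lt_two hpos.ne').2
        (this.trans_le (Nat.pow_le_pow_right (by norm_num) (Nat.le_succ _))))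
  have h2 : Nat.size f.a.toNat ≤ (intE f.a).length := by
    rw [Nat.size_le]
    have := abs_lt_two_pow_length_intE f.a
    have h3 : f.a ≤ |f.a| := le_abs_self _
    have h4 : (f.a.toNat : ℤ) < 2 ^ (intE f.a).length := by
      rcases le_or_gt 0 f.a with h0 | hneg
      · rw [Int.toNat_of_nonneg h0]; linarith
      · rw [Int.toNat_of_nonpos hneg.le]; positivity
    exact_mod_cast h4
  have h3 : (intE f.a).length ≤ (formE f).length := by
    have e : formE f = boolPair (intE f.a) (boolPair (intE f.b) (intE f.c)) := rfl
    rw [e, length_boolPair]; omega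
  omega

/-- **On a primitive positive definite form of discriminant `D < 0`, the guarded reduction is the
reduction** of `HallgrenClassGroupReduction.lean`. [cite: Cox2013, §2.A Thm. 2.8] -/
theorem reduceG_eq_reduce {D : ℤ} (hD : D < 0) {f : BinQF} (hf : f.IsPosPrim D) : reduceG D f = reduce f := by
  have hp : posDef D f := ⟨hf.a_pos, hf.disc_eq, hD⟩
  rw [reduceG, stepG_iterate_eq hp]
  obtain ⟨k, hk⟩ := Nat.exists_eq_add_of_le (reduceSteps_le_budget f)
  rw [hk, Nat.add_comm, Function.iterate_add_apply]
  change step^[k] (reduce f) = reduce f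
  exact step_iterate_eq_self_of_isReduced (isPosPrim_reduce hD hf).a_pos (isReduced_reduce hD hf) k

/-- `reduceG` on codes. [cite: AroraBarak2009, §1.3] -/
theorem reduceGC : CodeFP (pairE intE formE) formE (fun p => reduceG p.1 p.2) := by
  have h1 : CodeFP (pairE intE formE) strE (fun p => formE p.2) := (recode (fun _ => rfl)).comp (snd intE formE)
  have h2 := strLength.comp h1
  have hlen := unSucc.comp (unSucc.comp (unSucc.comp (unSucc.comp h2)))
  have hbud := replicateUnit.comp hlen
  have h := stepGIterC.comp ((CodeFP.id (pairE intE formE)).pair hbud)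
  refine h.congr fun p => ?_
  simp only [reduceG, List.length_replicate, id]

/-! ### The guarded composition -/

/-- Validity of an input of the composition: primitive positive definite forms of discriminant
`D < 0`. [folklore] -/
def compValid (D : ℤ) (f g : BinQF) : Prop := f.IsPosPrim D ∧ g.IsPosPrim D ∧ D < 0

/-- Validity is decidable. [folklore] -/
instance (D : ℤ) (f g : BinQF) : Decidable (compValid D f g) := inferInstanceAs (Decidable (_ ∧ _ ∧ _))

/-- `decide (f.IsPosPrim D)` on codes. [folklore] -/
theorem isPosPrimC : CodeFP (pairE intE formE) bitE (fun p => decide (p.2.IsPosPrim p.1)) := by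
  have hD : CodeFP (pairE intE formE) intE (fun p => p.1) := fst intE formE
  have hf : CodeFP (pairE intE formE) formE (fun p => p.2) := snd intE formE
  have ha := aC.comp hf
  have hb := bC.comp hf
  have hc := cC.comp hf
  have h0 : CodeFP (pairE intE formE) intE (fun _ => (0 : ℤ)) := const _ (0 : ℤ)
  have h4 : CodeFP (pairE intE formE) intE (fun _ => (4 : ℤ)) := const _ (4 : ℤ)
  have h1n : CodeFP (pairE intE formE) natE (fun _ => (1 : ℕ)) := const _ (1 : ℕ)
  have hdisc := intSub.comp ((intMul.comp (hb.pair hb)).pair (intMul.comp ((intMul.comp (h4.pair ha)).pair hc)))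
  have hg1 := (natGcdABC.comp ((intNatAbs.comp ha).pair (intNatAbs.comp hb))).fst'
  have hg2 := (natGcdABC.comp (hg1.pair (intNatAbs.comp hc))).fst'
  have hprim := natEq.comp (hg2.pair h1n)
  have h := (intEq.comp (hdisc.pair hD)).and ((intLt.comp (h0.pair ha)).and hprim)
  refine h.congr fun p => ?_
  have : p.2.IsPosPrim p.1 ↔ p.2.disc = p.1 ∧ 0 < p.2.a ∧ p.2.IsPrimitive :=
    ⟨fun h => ⟨h.disc_eq, h.a_pos, h.primitive⟩, fun h => ⟨h.1, h.2.1, h.2.2⟩⟩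
  rw [Bool.eq_iff_iff]
  simp only [Bool.and_eq_true, decide_eq_true_eq, this, BinQF.disc, sq, BinQF.IsPrimitive]

/-- `decide (compValid D f g)` on codes. [folklore] -/
theorem compValidC : CodeFP (pairE intE (pairE formE formE)) bitE (fun p => decide (compValid p.1 p.2.1 p.2.2)) := by
  have hD : CodeFP (pairE intE (pairE formE formE)) intE (fun p => p.1) := fst intE (pairE formE formE)
  have hfg : CodeFP (pairE intE (pairE formE formE)) (pairE formE formE) (fun p => p.2) := snd intE (pairE formE formE)
  have h0 : CodeFP (pairE intE (pairE formE formE)) intE (fun _ => (0 : ℤ)) := const _ (0 : ℤ)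
  have h1 := isPosPrimC.comp (hD.pair hfg.fst')
  have h2 := isPosPrimC.comp (hD.pair hfg.snd')
  have h3 := intLt.comp (hD.pair h0)
  refine (h1.and (h2.and h3)).congr fun p => ?_
  simp only [compValid, Bool.decide_and]

/-- **The guarded composition**: `compose D f g` on primitive positive definite `f, g` of
discriminant `D < 0`, else `f`. [cite: Cox2013, §3.A (composition)] -/
def composeG (D : ℤ) (f g : BinQF) : BinQF := if compValid D f g then reduceG D (rawCompose D f g) else f

/-- On valid inputs the guarded composition is `compose`. [cite: Cox2013, §3.A] -/
theorem composeG_eq_compose {D : ℤ} {f g : BinQF} (hD : D < 0) (hf : f.IsPosPrim D) (hg : g.IsPosPrim D) :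
    composeG D f g = compose D f g := by
  rw [composeG, if_pos ⟨hf, hg, hD⟩, compose]
  exact reduceG_eq_reduce hD (isPosPrim_rawCompose' ⟨D, hD⟩ hf hg)

/-- `composeG` on codes. [cite: AroraBarak2009, §1.3] -/
theorem composeGC : CodeFP (pairE intE (pairE formE formE)) formE (fun p => composeG p.1 p.2.1 p.2.2) := by
  have hD : CodeFP (pairE intE (pairE formE formE)) intE (fun p => p.1) := fst intE (pairE formE formE)
  have hf : CodeFP (pairE intE (pairE formE formE)) formE (fun p => p.2.1) := (snd intE (pairE formE formE)).fst'
  have hred := reduceGC.comp (hD.pair rawComposeC)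
  have h := ite compValidC hred hf
  refine h.congr fun p => ?_
  rw [composeG]
  by_cases hv : compValid p.1 p.2.1 p.2.2 <;> simp [hv]

/-- **A reduced positive definite form of discriminant `D` has all coefficients `≤ |D|`**
(`|b| ≤ a ≤ c` and `3ac ≤ 4ac − b² = |D|`). [cite: Cox2013, §2.A (2.12)] -/
theorem coeffs_le_of_isReduced {D : ℤ} {f : BinQF} (hp : posDef D f) (hr : f.IsReduced) :
    |f.a| ≤ |D| ∧ |f.b| ≤ |D| ∧ |f.c| ≤ |D| := by
  obtain ⟨ha, hdisc, hD⟩ := hp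
  obtain ⟨hba, hac, -⟩ := hr
  have hd : f.b ^ 2 - 4 * f.a * f.c = D := hdisc
  have hb2 : f.b ^ 2 ≤ f.a * f.c := by
    have h1 : |f.b| * |f.b| ≤ f.a * f.c := mul_le_mul hba (hba.trans hac) (abs_nonneg _) ha.le
    nlinarith [abs_mul_abs_self f.b]
  have hc0 : 0 < f.c := lt_of_lt_of_le ha hac
  have h3 : 3 * (f.a * f.c) ≤ -D := by nlinarith
  have hDabs : |D| = -D := abs_of_neg hD
  rw [hDabs, abs_of_pos ha, abs_of_pos hc0]
  refine ⟨by nlinarith, ?_, by nlinarith⟩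
  calc |f.b| ≤ f.a := hba
    _ ≤ -D := by nlinarith

/-- **Values of the guarded composition are small**: either the first argument, or a reduced
positive definite form of discriminant `D` (coefficients `≤ |D|`). [folklore] -/
theorem composeG_eq_or_bound (D : ℤ) (f g : BinQF) :
    composeG D f g = f ∨ (posDef D (composeG D f g) ∧ (composeG D f g).IsReduced) := by
  by_cases hv : compValid D f g
  · right
    obtain ⟨hf, hg, hD⟩ := hv
    rw [composeG_eq_compose hD hf hg]
    have h1 := isPosPrim_compose' ⟨D, hD⟩ hf hg
    exact ⟨⟨h1.a_pos, h1.disc_eq, hD⟩, isReduced_compose' ⟨D, hD⟩ hf hg⟩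
  · left; exact if_neg hv

end ClFP

end Literature.Computability.Cryptography.Hallgren2005
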